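import Summits.Ventures.CertifiedArithmetic.LowPrec.GemmEnvelopeScaled
import Summits.Ventures.CertifiedArithmetic.LowPrec.GemmEnvelopeWitnesses

/-!
# GEMM-level envelopes, part (k): the masked-cell TRANSFER — `VEC-E4M3 ≼ MXC` on `C(κ)` for EVERY `κ ≥ 1` (pub-lowprec gemm gen 22, LXX-k)

HONEST FRAMING: certified error envelopes and provably optimal rounding/accumulation schemes for
low-precision formats under stated cost models; every table by two implementations; no hardware or
vendor claims.

The per-vector-vs-MX comparisons so far (`row_P2_vecE4M3_le_mxCeil`, `κ ≤ 28672`; the sliver extension to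
`κ ≤ 516096/17`) bound the per-vector error by an explicit constant.  This file removes every range
restriction by a TRANSFER PRINCIPLE that needs no envelope value at all: the relative error of any single
per-vector product cell `q(a)·q(b) − a·b` (numerators `Aa, Ab`, scales `Aa/448, Ab/448`) is reproduced
EXACTLY as the relative GEMM error of an MX-ceil input in the same class `C(κ)` — the masked blocks
`(448, 0, y_a, 0, …)·(0, 448, y_b, 0, …)` with `y_a = 448|a|/Aa`, `y_b = 448|b|/Ab` (block maximum `448`
pins the power-of-two ceil scale to `1`, so the MX path rounds `y_a, y_b` exactly as the per-vector path
does; the class constraint `448 ≤ κ·y_a` is the per-vector constraint `Aa ≤ κ|a|` rescaled).  Hence any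
`q` bounding the MX error on `C(κ)` bounds every per-vector cell, and summing cells bounds the per-vector
GEMM error: `row_vecE4M3_le_mxCeil_transfer` — `VEC-E4M3 ≼ MXC` on `C(κ)` for all `κ ≥ 1`, blocks of
length `≥ 3` (three positions: two pins and the payload), any exact-accumulation GEMM shape.  The converse
inclusion is a different matter (it fails beyond `θ = 258048/17`, `GemmEnvelopeRowP5`).
[cite: RouhaniEtAl2023MX, §5.1, §6.3]; [cite: MicikeviciusEtAl2022, §3]
-/

namespace Summit.Ventures.CertifiedArithmetic.LowPrec.GemmEnvelope

open Finset
open Literature.ComputerArithmetic.FloatingPoint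
open Literature.ComputerArithmetic.FloatingPoint.Format
open Literature.ComputerArithmetic.FloatingPoint.MiniFloat
open Literature.ComputerArithmetic.FloatingPoint.MXBlock
open Summit.Ventures.CertifiedArithmetic.LowPrec.SR

/-- Sign normal form of a scaled RNE quantiser: `a = σ·|a|` and `X·q(a/X) = σ·X·q(|a|/X)` with `|σ| = 1`
(RNE is odd). [folklore] -/
theorem scaled_sign_form (φ : Format) (X a : ℚ) :
    ∃ σ : ℚ, |σ| = 1 ∧ a = σ * |a| ∧
      X * (roundNE φ (a / X)).toRat = σ * (X * (roundNE φ (|a| / X)).toRat) := by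
  rcases le_or_gt 0 a with ha | ha
  · exact ⟨1, by simp, by rw [abs_of_nonneg ha, one_mul], by rw [abs_of_nonneg ha, one_mul]⟩
  · refine ⟨-1, by simp, by rw [abs_of_neg ha]; ring, ?_⟩
    have e : a / X = -(|a| / X) := by rw [abs_of_neg ha]; ring
    rw [e, toRat_roundNE_neg]; ring

/-- THE MASKED-CELL TRANSFER: if `q` bounds the MX-E4M3 (ceil scale) GEMM error on `C(κ)` (blocks of length
`n + 3`, `B ≥ 1` blocks), then `q` bounds the relative error of every single per-vector E4M3 product cell
whose operands satisfy the class constraints, for any `κ ≥ 1`. [cite: RouhaniEtAl2023MX, §6.3] -/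
theorem vec_cell_le_of_mx_bound {B n : ℕ} (hB : 0 < B) {κ : ℚ} (hκ : 1 ≤ κ) (q : ℚ)
    (hY : ∀ (a b : Fin B → Fin (n + 3) → ℚ) (Aa Ab : ℚ),
      (∀ j i, |a j i| ≤ Aa ∧ (a j i = 0 ∨ Aa ≤ κ * |a j i|)) →
      (∀ j i, |b j i| ≤ Ab ∧ (b j i = 0 ∨ Ab ≤ κ * |b j i|)) →
      |∑ j, ∑ i, (ceilScale E4M3 (a j) * (roundNE E4M3 (a j i / ceilScale E4M3 (a j))).toRat) *
          (ceilScale E4M3 (b j) * (roundNE E4M3 (b j i / ceilScale E4M3 (b j))).toRat)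
          - ∑ j, ∑ i, a j i * b j i| ≤ q * ∑ j, ∑ i, |a j i * b j i|)
    {a b Aa Ab : ℚ} (ha : |a| ≤ Aa ∧ (a = 0 ∨ Aa ≤ κ * |a|)) (hb : |b| ≤ Ab ∧ (b = 0 ∨ Ab ≤ κ * |b|)) :
    |(Aa / E4M3.maxRat * (roundNE E4M3 (a / (Aa / E4M3.maxRat))).toRat) *
        (Ab / E4M3.maxRat * (roundNE E4M3 (b / (Ab / E4M3.maxRat))).toRat) - a * b| ≤ q * |a * b| := by
  have hM : E4M3.maxRat = 448 := by decide +kernel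
  by_cases ha0 : a = 0
  · rw [ha0, GemmEnvelope.scaled_zero E4M3 (Aa / E4M3.maxRat)]; simp
  by_cases hb0 : b = 0
  · rw [hb0, GemmEnvelope.scaled_zero E4M3 (Ab / E4M3.maxRat)]; simp
  have hapos : 0 < |a| := abs_pos.mpr ha0
  have hbpos : 0 < |b| := abs_pos.mpr hb0
  have hAa : 0 < Aa := lt_of_lt_of_le hapos ha.1
  have hAb : 0 < Ab := lt_of_lt_of_le hbpos hb.1
  rw [hM]
  set X : ℚ := Aa / 448 with hXdef
  set Y : ℚ := Ab / 448 with hYdef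
  have hX : 0 < X := by positivity
  have hYp : 0 < Y := by positivity
  set ya : ℚ := |a| / X with hya
  set yb : ℚ := |b| / Y with hyb
  have hya0 : 0 < ya := by positivity
  have hyb0 : 0 < yb := by positivity
  have hyaM : ya ≤ 448 := by
    rw [hya, div_le_iff₀ hX, hXdef]; linarith [ha.1]
  have hybM : yb ≤ 448 := by
    rw [hyb, div_le_iff₀ hYp, hYdef]; linarith [hb.1]
  have hκa : (448 : ℚ) ≤ κ * ya := by
    have h1 : Aa ≤ κ * |a| := ha.2.resolve_left ha0
    rw [hya, mul_div_assoc', le_div_iff₀ hX, hXdef]; linarith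
  have hκb : (448 : ℚ) ≤ κ * yb := by
    have h1 : Ab ≤ κ * |b| := hb.2.resolve_left hb0
    rw [hyb, mul_div_assoc', le_div_iff₀ hYp, hYdef]; linarith
  have hκM : (448 : ℚ) ≤ κ * 448 := by nlinarith
  have hpos448 : (0 : ℚ) < 448 := by norm_num
  -- the MX witness blocks
  set a' : Fin (n + 3) → ℚ :=
    Fin.cases (448 : ℚ) (Fin.cases (0 : ℚ) (Fin.cases ya (fun _ : Fin n => (0 : ℚ)))) with ha'
  set b' : Fin (n + 3) → ℚ :=
    Fin.cases (0 : ℚ) (Fin.cases (448 : ℚ) (Fin.cases yb (fun _ : Fin n => (0 : ℚ)))) with hb'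
  have haM : ∀ i, |a' i| ≤ 448 := by
    intro i; rw [ha']
    refine Fin.cases ?_ (fun i₁ => Fin.cases ?_ (fun i₂ => Fin.cases ?_ (fun _ => ?_) i₂) i₁) i
    · simp only [Fin.cases_zero]; rw [abs_of_pos hpos448]
    · simp only [Fin.cases_succ, Fin.cases_zero, abs_zero]; exact hpos448.le
    · simp only [Fin.cases_succ, Fin.cases_zero]; rwa [abs_of_pos hya0]
    · simp only [Fin.cases_succ, abs_zero]; exact hpos448.le
  have hbM : ∀ i, |b' i| ≤ 448 := by
    intro i; rw [hb']
    refine Fin.cases ?_ (fun i₁ => Fin.cases ?_ (fun i₂ => Fin.cases ?_ (fun _ => ?_) i₂) i₁) i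
    · simp only [Fin.cases_zero, abs_zero]; exact hpos448.le
    · simp only [Fin.cases_succ, Fin.cases_zero]; rw [abs_of_pos hpos448]
    · simp only [Fin.cases_succ, Fin.cases_zero]; rwa [abs_of_pos hyb0]
    · simp only [Fin.cases_succ, abs_zero]; exact hpos448.le
  have hmemA : ∀ (j : Fin B) (i : Fin (n + 3)), |(fun _ : Fin B => a') j i| ≤ 448 ∧
      ((fun _ : Fin B => a') j i = 0 ∨ (448 : ℚ) ≤ κ * |(fun _ : Fin B => a') j i|) := by
    intro j i; refine ⟨haM i, ?_⟩
    show a' i = 0 ∨ (448 : ℚ) ≤ κ * |a' i|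
    rw [ha']
    refine Fin.cases ?_ (fun i₁ => Fin.cases ?_ (fun i₂ => Fin.cases ?_ (fun _ => ?_) i₂) i₁) i
    · simp only [Fin.cases_zero]; rw [abs_of_pos hpos448]; exact Or.inr hκM
    · simp only [Fin.cases_succ, Fin.cases_zero]
      first | exact Or.inl rfl | exact Or.inl trivial
    · simp only [Fin.cases_succ, Fin.cases_zero]; rw [abs_of_pos hya0]; exact Or.inr hκa
    · simp only [Fin.cases_succ]
      first | exact Or.inl rfl | exact Or.inl trivial
  have hmemB : ∀ (j : Fin B) (i : Fin (n + 3)), |(fun _ : Fin B => b') j i| ≤ 448 ∧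
      ((fun _ : Fin B => b') j i = 0 ∨ (448 : ℚ) ≤ κ * |(fun _ : Fin B => b') j i|) := by
    intro j i; refine ⟨hbM i, ?_⟩
    show b' i = 0 ∨ (448 : ℚ) ≤ κ * |b' i|
    rw [hb']
    refine Fin.cases ?_ (fun i₁ => Fin.cases ?_ (fun i₂ => Fin.cases ?_ (fun _ => ?_) i₂) i₁) i
    · simp only [Fin.cases_zero]
      first | exact Or.inl rfl | exact Or.inl trivial
    · simp only [Fin.cases_succ, Fin.cases_zero]; rw [abs_of_pos hpos448]; exact Or.inr hκM
    · simp only [Fin.cases_succ, Fin.cases_zero]; rw [abs_of_pos hyb0]; exact Or.inr hκb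
    · simp only [Fin.cases_succ]
      first | exact Or.inl rfl | exact Or.inl trivial
  -- block maxima `448` pin both ceil scales to `1`
  have hM0 : (0 : ℚ) < E4M3.maxRat := by rw [hM]; norm_num
  have hbmA : blockMax a' = 448 :=
    blockMax_eq_of_forall_le haM (i₀ := 0) (by rw [ha']; simp only [Fin.cases_zero]; rw [abs_of_pos hpos448])
  have hbmB : blockMax b' = 448 :=
    blockMax_eq_of_forall_le hbM (i₀ := 1)
      (by rw [hb']; simp only [show (1 : Fin (n + 3)) = (0 : Fin (n + 2)).succ from rfl, Fin.cases_succ,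
        Fin.cases_zero]; rw [abs_of_pos hpos448])
  have hsA : ceilScale E4M3 a' = 1 := by
    have h := ceilScale_eq_zpow hM0 (V := a') (e := 0) (by rw [hbmA, hM]; norm_num) (by rw [hbmA, hM]; norm_num)
    rw [h]; norm_num
  have hsB : ceilScale E4M3 b' = 1 := by
    have h := ceilScale_eq_zpow hM0 (V := b') (e := 0) (by rw [hbmB, hM]; norm_num) (by rw [hbmB, hM]; norm_num)
    rw [h]; norm_num
  -- the three block sums of the witness
  set Qa : ℚ := (roundNE E4M3 ya).toRat with hQa
  set Qb : ℚ := (roundNE E4M3 yb).toRat with hQb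
  have hS1 : ∑ i, (roundNE E4M3 (a' i)).toRat * (roundNE E4M3 (b' i)).toRat = Qa * Qb := by
    rw [Fin.sum_univ_succ, Fin.sum_univ_succ, Fin.sum_univ_succ, ha', hb', hQa, hQb]
    simp only [Fin.cases_zero, Fin.cases_succ, toRat_roundNE_zero, mul_zero, zero_mul, zero_add, add_zero,
      sum_const_zero]
  have hS2 : ∑ i, a' i * b' i = ya * yb := by
    rw [Fin.sum_univ_succ, Fin.sum_univ_succ, Fin.sum_univ_succ, ha', hb']
    simp only [Fin.cases_zero, Fin.cases_succ, mul_zero, zero_mul, zero_add, add_zero, sum_const_zero]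
  have hS3 : ∑ i, |a' i * b' i| = ya * yb := by
    rw [Fin.sum_univ_succ, Fin.sum_univ_succ, Fin.sum_univ_succ, ha', hb']
    simp only [Fin.cases_zero, Fin.cases_succ, mul_zero, zero_mul, abs_zero, zero_add, add_zero,
      sum_const_zero, abs_of_pos (mul_pos hya0 hyb0)]
  have hw := hY (fun _ => a') (fun _ => b') 448 448 hmemA hmemB
  simp only [hsA, hsB, div_one, one_mul, hS1, hS2, hS3, sum_const, card_univ, Fintype.card_fin,
    nsmul_eq_mul] at hw
  -- strip the factor `B`
  have hBq : (0 : ℚ) < (B : ℚ) := by exact_mod_cast hB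
  have hcell : |Qa * Qb - ya * yb| ≤ q * (ya * yb) := by
    have e1 : (B : ℚ) * (Qa * Qb) - (B : ℚ) * (ya * yb) = (B : ℚ) * (Qa * Qb - ya * yb) := by ring
    rw [e1, abs_mul, abs_of_pos hBq] at hw
    have e2 : q * ((B : ℚ) * (ya * yb)) = (B : ℚ) * (q * (ya * yb)) := by ring
    rw [e2] at hw
    exact le_of_mul_le_mul_left hw hBq
  -- back to the per-vector cell through the sign normal forms
  obtain ⟨σa, hσa, hae, hqa⟩ := scaled_sign_form E4M3 X a
  obtain ⟨σb, hσb, hbe, hqb⟩ := scaled_sign_form E4M3 Y b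
  have haX : |a| = X * ya := by rw [hya]; field_simp
  have hbY : |b| = Y * yb := by rw [hyb]; field_simp
  have hab : a * b = σa * σb * (X * Y) * (ya * yb) := by
    calc a * b = (σa * |a|) * (σb * |b|) := by rw [← hae, ← hbe]
      _ = σa * σb * (X * Y) * (ya * yb) := by rw [haX, hbY]; ring
  have hXY : 0 < X * Y := mul_pos hX hYp
  have hprod : X * (roundNE E4M3 (a / X)).toRat * (Y * (roundNE E4M3 (b / Y)).toRat) - a * b
      = σa * σb * (X * Y) * (Qa * Qb - ya * yb) := by
    rw [hqa, hqb, ← hya, ← hyb, ← hQa, ← hQb, hab]; ring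
  have habs : |a * b| = X * Y * (ya * yb) := by
    rw [hab, abs_mul, abs_mul, abs_mul, hσa, hσb, abs_of_pos hXY, abs_of_pos (mul_pos hya0 hyb0)]; ring
  rw [hprod, habs, abs_mul, abs_mul, abs_mul, hσa, hσb, abs_of_pos hXY, one_mul, one_mul]
  nlinarith [mul_le_mul_of_nonneg_left hcell hXY.le]

/-- **`VEC-E4M3 ≼ MXC` ON `C(κ)` FOR EVERY `κ ≥ 1`** (blocks of length `≥ 3`, exact accumulation): every `q`
bounding the MX-E4M3 ceil-scale GEMM error on `C(κ)` bounds the per-vector E4M3 GEMM error on `C(κ)` — by the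
masked-cell transfer, cell by cell.  Supersedes the range-restricted rows (`κ ≤ 28672`, `κ ≤ 516096/17`).
[cite: RouhaniEtAl2023MX, §5.1, §6.3]; [cite: MicikeviciusEtAl2022, §3] -/
theorem row_vecE4M3_le_mxCeil_transfer {B k : ℕ} (hB : 0 < B) (hk : 3 ≤ k) {κ : ℚ} (hκ : 1 ≤ κ) (q : ℚ)
    (hY : ∀ (a b : Fin B → Fin k → ℚ) (Aa Ab : ℚ),
      (∀ j i, |a j i| ≤ Aa ∧ (a j i = 0 ∨ Aa ≤ κ * |a j i|)) →
      (∀ j i, |b j i| ≤ Ab ∧ (b j i = 0 ∨ Ab ≤ κ * |b j i|)) →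
      |∑ j, ∑ i, (ceilScale E4M3 (a j) * (roundNE E4M3 (a j i / ceilScale E4M3 (a j))).toRat) *
          (ceilScale E4M3 (b j) * (roundNE E4M3 (b j i / ceilScale E4M3 (b j))).toRat)
          - ∑ j, ∑ i, a j i * b j i| ≤ q * ∑ j, ∑ i, |a j i * b j i|)
    (a b : Fin B → Fin k → ℚ) (Aa Ab : ℚ)
    (ha : ∀ j i, |a j i| ≤ Aa ∧ (a j i = 0 ∨ Aa ≤ κ * |a j i|))
    (hb : ∀ j i, |b j i| ≤ Ab ∧ (b j i = 0 ∨ Ab ≤ κ * |b j i|)) :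
    |∑ j, ∑ i, (Aa / E4M3.maxRat * (roundNE E4M3 (a j i / (Aa / E4M3.maxRat))).toRat) *
        (Ab / E4M3.maxRat * (roundNE E4M3 (b j i / (Ab / E4M3.maxRat))).toRat)
        - ∑ j, ∑ i, a j i * b j i| ≤ q * ∑ j, ∑ i, |a j i * b j i| := by
  obtain ⟨n, rfl⟩ : ∃ n, k = n + 3 := ⟨k - 3, by omega⟩
  have hcell : ∀ j i,
      |(Aa / E4M3.maxRat * (roundNE E4M3 (a j i / (Aa / E4M3.maxRat))).toRat) *
          (Ab / E4M3.maxRat * (roundNE E4M3 (b j i / (Ab / E4M3.maxRat))).toRat) - a j i * b j i|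
        ≤ q * |a j i * b j i| :=
    fun j i => vec_cell_le_of_mx_bound hB hκ q hY (ha j i) (hb j i)
  rw [← sum_sub_distrib]
  simp_rw [← sum_sub_distrib]
  refine le_trans (abs_sum_le_sum_abs _ _) ?_
  refine le_trans (sum_le_sum fun j _ => abs_sum_le_sum_abs _ _) ?_
  rw [mul_sum]
  refine sum_le_sum fun j _ => ?_
  rw [mul_sum]
  exact sum_le_sum fun i _ => hcell j i

end Summit.Ventures.CertifiedArithmetic.LowPrec.GemmEnvelope
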